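import Summits.QuantumFields.BalabanUV.Beta.LogZFubiniCompSlice

/-!
# `BalabanUV.Beta.PolarizationTelescopingCompSlice` — binder row D1, route (O3), END-TO-END AT MATRIX LEVEL: **FOR THE COMPOSED-SLICE TWO-LEVEL
# MATRIX MODEL PRESENTED IN FACTORED FORM, THE ONE-LOOP POLARIZATIONS TELESCOPE UP TO THE TADPOLE TERM — AND EXACTLY WHEN THE FINE ONE-SHOT
# FUNCTIONAL IS TADPOLE-FREE** (K-U2d's `logZ` Fubini + K-U2b's coordinate chain rule)
# (β sub-cell, BINDER-OWNERS row D1 OWNER, lineage an2 gen 23; sequel of K-U2d p238488; `ROUTE-O3.md` §3 W-1 + W-2 packaging)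

HONEST FRAMING (cell charter, verbatim): «discharging BetaPertH makes Balaban's UV stability UNCONDITIONAL — a real
constructive-QFT result; it is NOT the continuum limit and NOT the Clay problem.»
HONEST DEPENDENCY: continuum YM on T⁴ ⇐ BetaPertH ∧ nine spine estimates (0/9 proved); BetaPertH ⇐ (D1) ∧ (D4) ∧ CAP+tail;
G-an2-4 gates asym, D1 and NE2/3/4.
ABSOLUTE RULE (cell, verbatim): «No internally-minted statement may enter as a cited fact. Every hypothesis is either kernel-proved in this
package or a verbatim quotation of a PUBLISHED theorem with page reference. The manuscript(s) under audit are NOT citable for their own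
disputed steps — they are the thing under adjudication; programme-internal (2001/route/tribunal) claims are never citable.»
NOTHING below is cited: no `[cite: …]`, no `def`, no `Prop` fact.  Every declaration is [folklore] plumbing of K-U2d `LogZFubiniCompSlice.logZ_fubini_comp_slice'`
into K-U2b `PolarizationComposite.hessianAt_comp_eq` (`OneLoop.polarization = hessianAt ∘ Family.logZ` by `rfl`).  It asserts nothing about Bałaban's objects:
the FACTORED matrix-valued background functions `K̃, Q̃₁, Q̃₂, W̃₁` (functions of the LEVEL-1 background), the STEP MINIMISER MAP `U` (a C² map on backgrounds
with `U 0 = 0` — W-2's implicit-function data, here a HYPOTHESIS), the fixed slices `τ₁, τ₂`, an5's composed-slice hypotheses near the trivial background, and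
`C²` regularity of the fine and step functionals are PARAMETERS ∕ HYPOTHESES.

WHY (row-D1 owner, gen 23; `ROUTE-O3.md`).  This is the finite-dimensional END-TO-END form of FINDING X-an2-54 for the honest composite: with the fine data
presented as functions of the level-1 background composed with the step minimiser (`K = K̃ ∘ U`, …, which for honest objects is definitional — the fine
configuration is a function of the level-1 configuration), K-U2d gives `F_comp.logZ = F₁.logZ ∘ U + F_step.logZ + c` near `0` and K-U2b turns it into
`polarization F_comp i j = Σ_a Σ_b (∂_i U_a ∂_j U_b)·polarization F₁ a b + polarization F_step i j + Σ_a (∂_i∂_j U_a)·∂_a(F₁.logZ)(0)`: transported fine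
polarization + step polarization + TADPOLE·SECOND RESPONSE; if `F₁.logZ` is tadpole-free at `0` (a hypothesis; for the literal the parity theorems `SpineRecursiveParity` ∕
`KernelWardRelativeEnd.tadpole_eq_zero_of_parity` give the kernel-calculus `tadpole ≡ 0`, the functional-level statement needs the W-4 bridge — matrix half
`LogZFirstJet`, d1-formalise-ref F-d1ref28-1; generically K-U2c `fderiv_eq_zero_of_invariant`) the polarizations telescope EXACTLY — the finite-volume
shape of exact (SDF) for the composite family.  What remains for the ℤ⁴ literal: W-4 (`hessKer` of the periodised literal = `polarization` of the periodised
family) and the `T ↗ ℤ⁴` limit (road BF-x bricks).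

WHAT (all [folklore]): **`polarization_telescoping_comp_slice`** (with the tadpole term), **`polarization_telescoping_comp_slice_of_tadpoleFree`** (exact).
Provenance: β sub-cell, unit beta-an2 gen 23 (prover-b2b-balaban-beta-an2-g23-0), 2026-08-20; v1.1 (gen 24): DOCFIX only (currency of `htad`, F-d1ref28-1),
no declaration changed.  NOT (SDF), NOT D1, NOT `BetaPertH`, NOT continuum, NOT Clay.
-/

open Filter Topology Matrix Finset
open scoped Matrix BigOperators
open Literature.MathematicalPhysics.QuantumFieldTheory.Balaban1983to89.Beta (Family ConstrainedGaussian hessianAt polarization)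
open Literature.MathematicalPhysics.QuantumFieldTheory.Balaban1983to89.Beta.Composition (kkt)
open Literature.MathematicalPhysics.QuantumFieldTheory.Balaban1983to89.Beta.CompositionSingular (effForm)
open Summit.QuantumFields.BalabanUV.Beta.PolarizationComposite (hessianAt_comp_eq)
open Summit.QuantumFields.BalabanUV.Beta.LogZFubiniCompSlice (logZ_fubini_comp_slice')

namespace Summit.QuantumFields.BalabanUV.Beta.PolarizationTelescopingCompSlice

variable {ι κ : Type*} [Fintype ι] [DecidableEq ι] [Fintype κ] [DecidableEq κ] {n n₁ n₂ r₁ r₂ : ℕ}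

/-- [folklore] **ROUTE (O3) END-TO-END AT MATRIX LEVEL.**  Composed-slice two-level matrix model in FACTORED form: level-1-background functions
`K̃ : (κ → ℝ) → Matrix (Fin n) (Fin n) ℝ` (fine form), `Q̃₁` (fine averaging), `Q̃₂` (coarse averaging), `W̃₁` (fine gauge directions), fixed slices `τ₁, τ₂`,
and a step minimiser map `U : (ι → ℝ) → (κ → ℝ)` with `U 0 = 0`, C² at `0`; the COMPOSITE one-shot family `F_comp B := ⟨[Q̃₂Q̃₁; [τ₂Q̃₁; τ₁]](U B), K̃(U B)⟩`,
the FINE one-shot family `F₁ B₁ := ⟨[Q̃₁; τ₁](B₁), K̃ B₁⟩` (a function of the LEVEL-1 background), the STEP family `F_step B := ⟨[Q̃₂; τ₂](U B), 𝒮₁₁(U B)⟩`.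
If an5's composed-slice hypotheses hold near `0` along `U`, the fine and step functionals are C² at the base points, then for all `i j`:
`polarization F_comp i j = Σ_a Σ_b (∂_i U_a ∂_j U_b)·polarization F₁ a b + polarization F_step i j + Σ_a (∂_i∂_j U_a)·∂_a(F₁.logZ)(0)`. -/
theorem polarization_telescoping_comp_slice
    (Kt : (κ → ℝ) → Matrix (Fin n) (Fin n) ℝ) (Q₁t : (κ → ℝ) → Matrix (Fin n₁) (Fin n) ℝ) (Q₂t : (κ → ℝ) → Matrix (Fin n₂) (Fin n₁) ℝ)
    (W₁t : (κ → ℝ) → Matrix (Fin n) (Fin r₁) ℝ) (τ₁ : Matrix (Fin r₁) (Fin n) ℝ) (τ₂ : Matrix (Fin r₂) (Fin n₁) ℝ)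
    (e₂ : Fin (n₂ + (r₂ + r₁)) ≃ Fin n₂ ⊕ (Fin r₂ ⊕ Fin r₁)) (e₁ : Fin (n₁ + r₁) ≃ Fin n₁ ⊕ Fin r₁) (es : Fin (n₂ + r₂) ≃ Fin n₂ ⊕ Fin r₂)
    (U : (ι → ℝ) → (κ → ℝ)) (hU0 : U 0 = 0) (hU : ContDiffAt ℝ 2 U 0)
    (hKW : ∀ᶠ B in 𝓝 (0 : ι → ℝ), Kt (U B) * W₁t (U B) = 0) (hKtW : ∀ᶠ B in 𝓝 (0 : ι → ℝ), (Kt (U B))ᵀ * W₁t (U B) = 0)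
    (hQW : ∀ᶠ B in 𝓝 (0 : ι → ℝ), Q₁t (U B) * W₁t (U B) = 0) (hT : ∀ᶠ B in 𝓝 (0 : ι → ℝ), IsUnit (τ₁ * W₁t (U B)).det)
    (h1 : ∀ᶠ B in 𝓝 (0 : ι → ℝ), IsUnit (kkt (Kt (U B)) (fromRows (Q₁t (U B)) τ₁)).det)
    (h2 : ∀ᶠ B in 𝓝 (0 : ι → ℝ), IsUnit (kkt (effForm (Kt (U B)) (fromRows (Q₁t (U B)) τ₁)).toBlocks₁₁ (fromRows (Q₂t (U B)) τ₂)).det)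
    (hf : ContDiffAt ℝ 2 (Family.logZ (fun B₁ => ConstrainedGaussian.mk ((fromRows (Q₁t B₁) τ₁).submatrix e₁ id) (Kt B₁) : Family κ n (n₁ + r₁))) 0)
    (hφ : ContDiffAt ℝ 2 (Family.logZ (fun B => ConstrainedGaussian.mk ((fromRows (Q₂t (U B)) τ₂).submatrix es id)
      (effForm (Kt (U B)) (fromRows (Q₁t (U B)) τ₁)).toBlocks₁₁ : Family ι n₁ (n₂ + r₂))) 0)
    (i j : ι) :
    polarization (fun B => ConstrainedGaussian.mk ((fromRows (Q₂t (U B) * Q₁t (U B)) (fromRows (τ₂ * Q₁t (U B)) τ₁)).submatrix e₂ id) (Kt (U B)) :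
        Family ι n (n₂ + (r₂ + r₁))) i j =
      (∑ a, ∑ b, (fderiv ℝ U 0 (Pi.single i 1) a * fderiv ℝ U 0 (Pi.single j 1) b) *
          polarization (fun B₁ => ConstrainedGaussian.mk ((fromRows (Q₁t B₁) τ₁).submatrix e₁ id) (Kt B₁) : Family κ n (n₁ + r₁)) a b)
        + polarization (fun B => ConstrainedGaussian.mk ((fromRows (Q₂t (U B)) τ₂).submatrix es id)
            (effForm (Kt (U B)) (fromRows (Q₁t (U B)) τ₁)).toBlocks₁₁ : Family ι n₁ (n₂ + r₂)) i j
        + ∑ a, fderiv ℝ (fderiv ℝ U) 0 (Pi.single i 1) (Pi.single j 1) a *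
            fderiv ℝ (Family.logZ (fun B₁ => ConstrainedGaussian.mk ((fromRows (Q₁t B₁) τ₁).submatrix e₁ id) (Kt B₁) : Family κ n (n₁ + r₁))) 0
              (Pi.single a 1) := by
  -- K-U2d: the three functionals add near `0` (fine data written as functions of `B` through `U`)
  have hfub := logZ_fubini_comp_slice' (fun B => Kt (U B)) (fun B => Q₁t (U B)) (fun B => Q₂t (U B)) (fun B => W₁t (U B)) τ₁ τ₂ e₂ e₁ es
    hKW hKtW hQW hT h1 h2
  -- the fine family as a function of `B` IS the level-1 family composed with `U` (definitional)
  have hfac : Family.logZ (fun B => ConstrainedGaussian.mk ((fromRows (Q₁t (U B)) τ₁).submatrix e₁ id) (Kt (U B)) : Family ι n (n₁ + r₁))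
      = fun B => Family.logZ (fun B₁ => ConstrainedGaussian.mk ((fromRows (Q₁t B₁) τ₁).submatrix e₁ id) (Kt B₁) : Family κ n (n₁ + r₁)) (U B) := by
    funext B; rfl
  rw [hfac] at hfub
  simp only [Literature.MathematicalPhysics.QuantumFieldTheory.Balaban1983to89.Beta.polarization_eq_hessianAt]
  exact hessianAt_comp_eq hfub hU0 hU hf hφ i j

/-- [folklore] **THE SAME, TADPOLE-FREE: THE POLARIZATIONS TELESCOPE EXACTLY** — if the fine one-shot functional has no first jet at the trivial level-1
background (`fderiv ℝ F₁.logZ 0 = 0` — a HYPOTHESIS here; for the literal of record the parity theorems `SpineRecursiveParity` ∕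
`KernelWardRelativeEnd.tadpole_eq_zero_of_parity` give the KERNEL-CALCULUS statement `ExpKernelCalculus.tadpole ≡ 0`, and the functional-level `htad`
needs the W-4 bridge — matrix half `LogZFirstJet.fderiv_logZ_eq_zero_iff_of_constQ` ∕ `…_of_parity`, torus half OPEN; d1-formalise-ref F-d1ref28-1), then
`polarization F_comp i j = Σ_a Σ_b (∂_i U_a ∂_j U_b)·polarization F₁ a b + polarization F_step i j` — the finite-volume shape of EXACT (SDF) for the
composite comparison family. -/
theorem polarization_telescoping_comp_slice_of_tadpoleFree
    (Kt : (κ → ℝ) → Matrix (Fin n) (Fin n) ℝ) (Q₁t : (κ → ℝ) → Matrix (Fin n₁) (Fin n) ℝ) (Q₂t : (κ → ℝ) → Matrix (Fin n₂) (Fin n₁) ℝ)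
    (W₁t : (κ → ℝ) → Matrix (Fin n) (Fin r₁) ℝ) (τ₁ : Matrix (Fin r₁) (Fin n) ℝ) (τ₂ : Matrix (Fin r₂) (Fin n₁) ℝ)
    (e₂ : Fin (n₂ + (r₂ + r₁)) ≃ Fin n₂ ⊕ (Fin r₂ ⊕ Fin r₁)) (e₁ : Fin (n₁ + r₁) ≃ Fin n₁ ⊕ Fin r₁) (es : Fin (n₂ + r₂) ≃ Fin n₂ ⊕ Fin r₂)
    (U : (ι → ℝ) → (κ → ℝ)) (hU0 : U 0 = 0) (hU : ContDiffAt ℝ 2 U 0)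
    (hKW : ∀ᶠ B in 𝓝 (0 : ι → ℝ), Kt (U B) * W₁t (U B) = 0) (hKtW : ∀ᶠ B in 𝓝 (0 : ι → ℝ), (Kt (U B))ᵀ * W₁t (U B) = 0)
    (hQW : ∀ᶠ B in 𝓝 (0 : ι → ℝ), Q₁t (U B) * W₁t (U B) = 0) (hT : ∀ᶠ B in 𝓝 (0 : ι → ℝ), IsUnit (τ₁ * W₁t (U B)).det)
    (h1 : ∀ᶠ B in 𝓝 (0 : ι → ℝ), IsUnit (kkt (Kt (U B)) (fromRows (Q₁t (U B)) τ₁)).det)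
    (h2 : ∀ᶠ B in 𝓝 (0 : ι → ℝ), IsUnit (kkt (effForm (Kt (U B)) (fromRows (Q₁t (U B)) τ₁)).toBlocks₁₁ (fromRows (Q₂t (U B)) τ₂)).det)
    (hf : ContDiffAt ℝ 2 (Family.logZ (fun B₁ => ConstrainedGaussian.mk ((fromRows (Q₁t B₁) τ₁).submatrix e₁ id) (Kt B₁) : Family κ n (n₁ + r₁))) 0)
    (hφ : ContDiffAt ℝ 2 (Family.logZ (fun B => ConstrainedGaussian.mk ((fromRows (Q₂t (U B)) τ₂).submatrix es id)
      (effForm (Kt (U B)) (fromRows (Q₁t (U B)) τ₁)).toBlocks₁₁ : Family ι n₁ (n₂ + r₂))) 0)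
    (htad : fderiv ℝ (Family.logZ (fun B₁ => ConstrainedGaussian.mk ((fromRows (Q₁t B₁) τ₁).submatrix e₁ id) (Kt B₁) : Family κ n (n₁ + r₁))) 0 = 0)
    (i j : ι) :
    polarization (fun B => ConstrainedGaussian.mk ((fromRows (Q₂t (U B) * Q₁t (U B)) (fromRows (τ₂ * Q₁t (U B)) τ₁)).submatrix e₂ id) (Kt (U B)) :
        Family ι n (n₂ + (r₂ + r₁))) i j =
      (∑ a, ∑ b, (fderiv ℝ U 0 (Pi.single i 1) a * fderiv ℝ U 0 (Pi.single j 1) b) *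
          polarization (fun B₁ => ConstrainedGaussian.mk ((fromRows (Q₁t B₁) τ₁).submatrix e₁ id) (Kt B₁) : Family κ n (n₁ + r₁)) a b)
        + polarization (fun B => ConstrainedGaussian.mk ((fromRows (Q₂t (U B)) τ₂).submatrix es id)
            (effForm (Kt (U B)) (fromRows (Q₁t (U B)) τ₁)).toBlocks₁₁ : Family ι n₁ (n₂ + r₂)) i j := by
  rw [polarization_telescoping_comp_slice Kt Q₁t Q₂t W₁t τ₁ τ₂ e₂ e₁ es U hU0 hU hKW hKtW hQW hT h1 h2 hf hφ, htad]
  simp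

end Summit.QuantumFields.BalabanUV.Beta.PolarizationTelescopingCompSlice
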